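import Summits.FinalStateConjecture.FinalStateConjecture.Theorems.StarvedNecksSeamedChartsExhaustStubFirstContact
import Literature.Geometry.Lorentzian.KerrHyperboloidalLeaves

/-!
# Route StarvedNecks — crux `SeamedChartsExhaust`, line `wide-anchoring` (generation 2): RIDE, BOARDING, OPENNESS

Second file of the line (after the registered stubs `stub_firstContact`, `stub_rim`): chart bookkeeping of
an `N`-black-hole final-state decomposition `d` with certified radii `R`, threshold `R₀`, under the
clauses of HonestCore / SEAMED each lemma names explicitly. Kinematics of the CO-MOVING RIDE
`u ↦ x + u • Λⱼe₀` (rest-frame radius constant, hole clock `+u`, lab clock `+u (Λⱼe₀)⁰`); `tubeRide`: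
ride-able certified tube points (`(τ₀ ≤ tⱼ ∨ τ₀ ≤ x⁰) ∧ R₀ ≤ rⱼ ≤ Rⱼ(tⱼ) ∧ tⱼ ≤ τ₁`) lie in
`J⁻(certifiedSlab d R τ₁)` (future causal by SEAMED (5), adapter `Negative.line_mem_causalFuture`);
`contact_mem_rideable`: a flat-late contact point is ride-able (one atlas (6) via (7), `r₊ < R₀`,
clock lag (9)); `flatBoarding` (BOARD): flat-late points with lab time in `(τ₀, τ₁]` lie in
`J⁻(certifiedSlab d R τ₁)` (FIRST CONTACT `stub_firstContact` + ride); `collar_flat`: collar points are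
flat-late in the same coordinates ((9), (8), (12), (6)); `isOpen_certifiedLate`: the certified late
region is OPEN (lateral walls are flat-late interior points).

References: B. O'Neill, *Semi-Riemannian geometry*, Academic Press 1983, Ch. 9, p. 236 (Poincaré maps),
Ch. 14, pp. 402–403 (causality relations); M. Dafermos, G. Holzegel, I. Rodnianski, M. Taylor,
arXiv:2104.08222, §1 (late-time charts, near zones).
-/

noncomputable section

set_option linter.dupNamespace false

open Set Filter Topology Function TopologicalSpace
open scoped Manifold ContDiff ENNReal Topology
open Literature.Geometry.Lorentzian
open Summit.FinalStateConjecture.FinalStateConjecture.Theorems.SeamedChartsExhaust.Negative (line_mem_causalFuture)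

namespace Summit.FinalStateConjecture.FinalStateConjecture.Theorems.SeamedChartsExhaust.WideAnchoring

/-! ## Kinematics of the co-moving ride `u ↦ x + u • Λⱼe₀` -/

section Kinematics

/-- Translating along the time axis does not change the Kerr–Schild radius (`r` is spatial). [folklore] -/
theorem radius_add_smul_e₀ (a u : ℝ) (p : E4) :
    Kerr.radius a (p + u • E4.basisVector 0) = Kerr.radius a p := by
  have h3 : (p + u • E4.basisVector 0) 3 = p 3 := by
    simp [E4.basisVector]
  have hn : E4.spatialNorm (p + u • E4.basisVector 0) = E4.spatialNorm p := by
    simp [E4.spatialNorm, map_add, map_smul, E4.spatial_basisVector_zero]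
  simp only [Kerr.radius, hn, h3]

/-- The inverse Poincaré map is affine: a step `u • Λe₀` in the lab is a step `u • e₀` in the rest
frame, `Λ⁻¹(x + uΛe₀ − c) = Λ⁻¹(x − c) + u e₀`. O'Neill 1983, Ch. 9, p. 236. [folklore] -/
theorem poincareInv_add_smul (Λ : lorentzGroup) (c p : E4) (u : ℝ) :
    poincareInv Λ c (p + u • (Λ : E4 ≃L[ℝ] E4) (E4.basisVector 0)) =
      poincareInv Λ c p + u • E4.basisVector 0 := by
  simp only [poincareInv]
  have : p + u • (Λ : E4 ≃L[ℝ] E4) (E4.basisVector 0) - c =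
      (p - c) + u • (Λ : E4 ≃L[ℝ] E4) (E4.basisVector 0) := by abel
  rw [this, map_add, map_smul, ContinuousLinearEquiv.symm_apply_apply]

variable {𝓢 : Spacetime.{0} 4} {O : Set 𝓢.carrier} {k : ℕ} (d : FinalStateDecomposition 𝓢 O k)
  (j : Fin d.N)

/-- Along the ride the hole clock rises at unit rate: `t*ⱼ(x + uΛⱼe₀) = t*ⱼ(x) + u`. [folklore] -/
theorem time_ride (p : E4) (u : ℝ) :
    (d.background j).time (p + u • ((d.motion j).1 : E4 ≃L[ℝ] E4) (E4.basisVector 0)) =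
      (d.background j).time p + u := by
  show poincareInv (d.motion j).1 (d.motion j).2
      (p + u • ((d.motion j).1 : E4 ≃L[ℝ] E4) (E4.basisVector 0)) 0 =
    poincareInv (d.motion j).1 (d.motion j).2 p 0 + u
  rw [poincareInv_add_smul]
  simp

/-- Along the ride the rest-frame Kerr–Schild radius is constant. [folklore] -/
theorem radius_ride (p : E4) (u : ℝ) :
    (d.background j).radius (p + u • ((d.motion j).1 : E4 ≃L[ℝ] E4) (E4.basisVector 0)) =
      (d.background j).radius p := by
  show Kerr.radius (d.spin j) (poincareInv (d.motion j).1 (d.motion j).2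
      (p + u • ((d.motion j).1 : E4 ≃L[ℝ] E4) (E4.basisVector 0))) =
    Kerr.radius (d.spin j) (poincareInv (d.motion j).1 (d.motion j).2 p)
  rw [poincareInv_add_smul, radius_add_smul_e₀]

/-- Along the ride the lab clock moves at rate `(Λⱼe₀)⁰` (positive for an orthochronous `Λⱼ`). [folklore] -/
theorem coord0_ride (p : E4) (u : ℝ) :
    (p + u • ((d.motion j).1 : E4 ≃L[ℝ] E4) (E4.basisVector 0)) 0 =
      p 0 + u * ((d.motion j).1 : E4 ≃L[ℝ] E4) (E4.basisVector 0) 0 := by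
  simp

/-- The ride never leaves hole `j`'s chart domain (the boosted Kerr exterior is `{rⱼ > max(r₊, 0)}`
and `rⱼ` is constant along it). [folklore] -/
theorem mem_domain_ride {p : E4} (hp : p ∈ (d.background j).domain) (u : ℝ) :
    p + u • ((d.motion j).1 : E4 ≃L[ℝ] E4) (E4.basisVector 0) ∈ (d.background j).domain := by
  have hp' : poincareInv (d.motion j).1 (d.motion j).2 p ∈ Kerr.exterior (d.mass j) (d.spin j) := hp
  show poincareInv (d.motion j).1 (d.motion j).2
      (p + u • ((d.motion j).1 : E4 ≃L[ℝ] E4) (E4.basisVector 0)) ∈ Kerr.exterior (d.mass j) (d.spin j)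
  rw [poincareInv_add_smul, Kerr.mem_exterior, radius_add_smul_e₀]
  exact Kerr.mem_exterior.mp hp'


end Kinematics

/-! ## Causal bookkeeping -/

section Flow

variable {𝓢 : Spacetime.{0} 4}

/-- `J⁻` is transitive over sets: `x ≤ y` and `y ∈ J⁻(S)` give `x ∈ J⁻(S)`
(`causalFuture_causalFuture_eq` for the reversed time orientation). O'Neill 1983, Ch. 14, p. 402. [folklore] -/
theorem causalPast_trans {S : Set 𝓢.carrier} {x y : 𝓢.carrier}
    (hxy : x ∈ 𝓢.metric.causalPast 𝓢.timeOrientation {y})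
    (hyS : y ∈ 𝓢.metric.causalPast 𝓢.timeOrientation S) :
    x ∈ 𝓢.metric.causalPast 𝓢.timeOrientation S := by
  have hn2 : (2 : WithTop ℕ∞) ≤ ((⊤ : ℕ∞) : WithTop ℕ∞) := WithTop.coe_le_coe.mpr le_top
  have h : x ∈ 𝓢.metric.causalFuture 𝓢.timeOrientation.reverse
      (𝓢.metric.causalFuture 𝓢.timeOrientation.reverse S) :=
    LorentzianMetric.causalFuture_mono (Set.singleton_subset_iff.mpr hyS) hxy
  rw [LorentzianMetric.causalFuture_causalFuture_eq hn2] at h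
  exact h

end Flow

/-! ## The ride, boarding at a contact point, BOARD -/

/-- **The co-moving ride drains the ride-able set** (RIDE): a ride-able certified tube point `Ψⱼ x` lies in `J⁻` of the
certified slab at `τ₁` — the segment `u ↦ Ψⱼ(x + uΛⱼe₀)`, `u ∈ [0, τ₁ − t*ⱼ x]`, has constant
rest-frame radius (`radius_ride`), hole clock `+u` (`time_ride`), lab clock `+u(Λⱼe₀)⁰ ≥ 0`
(`horth`, orthochronous HonestCore (a)), so the window of SEAMED (5) persists along it (`hmono`,
SEAMED (1)) and it is a future causal curve (`line_mem_causalFuture`) ending on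
`truncTimeSlab (Rⱼ τ₁) τ₁ ⊆ certifiedSlab`. Clauses: Hc (a)-orthochronous, Sm (1)-monotone, Sm (5).
O'Neill 1983, Ch. 14, p. 402; DHRT arXiv:2104.08222, §1. [folklore] -/
theorem tubeRide (𝓢 : Spacetime.{0} 4) (O : Set 𝓢.carrier) (d : FinalStateDecomposition 𝓢 O 2)
    (R : Fin d.N → ℝ → ℝ) (R₀ : ℝ)
    (horth : ∀ i, 0 < ((d.motion i).1 : E4 ≃L[ℝ] E4) (E4.basisVector 0) 0)
    (hmono : ∀ i, Monotone (R i))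
    (h5 : ∀ i (x : (d.background i).domain),
      (d.τ₀ ≤ (d.background i).time x.1 ∨ d.τ₀ ≤ x.1 0) → R₀ ≤ (d.background i).radius x.1 →
      (d.background i).radius x.1 ≤ R i ((d.background i).time x.1) →
      𝓢.timeOrientation.IsFutureDirected
        (mfderiv 𝓘(ℝ, E4) (𝓡 4) (d.chart i) x (((d.motion i).1 : E4 ≃L[ℝ] E4) (E4.basisVector 0))))
    (τ₁ : ℝ) :
    (⋃ j, d.chart j '' {x | (d.τ₀ ≤ (d.background j).time x.1 ∨ d.τ₀ ≤ x.1 0) ∧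
        R₀ ≤ (d.background j).radius x.1 ∧
        (d.background j).radius x.1 ≤ R j ((d.background j).time x.1) ∧
        (d.background j).time x.1 ≤ τ₁}) ⊆
      𝓢.metric.causalPast 𝓢.timeOrientation (certifiedSlab d R τ₁) := by
  intro z hz
  obtain ⟨j, hz⟩ := mem_iUnion.mp hz
  obtain ⟨x, ⟨hlate, hr₀, hrR, ht⟩, rfl⟩ := hz
  have hmem : ∀ σ : ℝ, x.1 + σ • ((d.motion j).1 : E4 ≃L[ℝ] E4) (E4.basisVector 0) ∈
      (d.background j).domain := fun σ ↦ mem_domain_ride d j x.2 σ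
  have hs0 : 0 ≤ τ₁ - (d.background j).time x.1 := by linarith
  have key := line_mem_causalFuture (d.isLateChart j).contMDiff
    (((d.motion j).1 : E4 ≃L[ℝ] E4) (E4.basisVector 0)) x.1 x.2 hs0 one_pos (fun σ _ ↦ hmem σ) ?_
  · -- the endpoint lies on the hole disc of the certified slab
    have hzT : (⟨x.1 + (τ₁ - (d.background j).time x.1) •
        ((d.motion j).1 : E4 ≃L[ℝ] E4) (E4.basisVector 0), hmem _⟩ : (d.background j).domain) ∈
        (d.background j).truncTimeSlab (R j τ₁) τ₁ := by
      constructor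
      · show (d.background j).time (x.1 + (τ₁ - (d.background j).time x.1) •
            ((d.motion j).1 : E4 ≃L[ℝ] E4) (E4.basisVector 0)) = τ₁
        rw [time_ride]
        ring
      · show (d.background j).radius (x.1 + (τ₁ - (d.background j).time x.1) •
            ((d.motion j).1 : E4 ≃L[ℝ] E4) (E4.basisVector 0)) ≤ R j τ₁
        rw [radius_ride]
        exact hrR.trans (hmono j ht)
    have hzS : d.chart j ⟨x.1 + (τ₁ - (d.background j).time x.1) •
        ((d.motion j).1 : E4 ≃L[ℝ] E4) (E4.basisVector 0), hmem _⟩ ∈ certifiedSlab d R τ₁ :=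
      Or.inr (mem_iUnion.mpr ⟨j, _, hzT, rfl⟩)
    exact LorentzianMetric.causalFuture_mono (singleton_subset_iff.mpr hzS)
      (LorentzianMetric.mem_causalPast_of_mem_causalFuture key)
  · -- future-directedness of `dΨⱼ(Λⱼe₀)` along the segment: SEAMED (5)
    rintro ⟨z, hz⟩ ⟨σ, hσ, hzσ⟩
    have hzσ' : z = x.1 + σ • ((d.motion j).1 : E4 ≃L[ℝ] E4) (E4.basisVector 0) := hzσ.symm
    subst hzσ'
    have hσ0 : 0 ≤ σ := hσ.1
    refine h5 j ⟨_, hz⟩ ?_ ?_ ?_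
    · rcases hlate with h | h
      · left
        show d.τ₀ ≤ (d.background j).time (x.1 + σ • ((d.motion j).1 : E4 ≃L[ℝ] E4) (E4.basisVector 0))
        rw [time_ride]
        linarith
      · right
        show d.τ₀ ≤ (x.1 + σ • ((d.motion j).1 : E4 ≃L[ℝ] E4) (E4.basisVector 0)) 0
        rw [coord0_ride]
        have hprod : 0 ≤ σ * ((d.motion j).1 : E4 ≃L[ℝ] E4) (E4.basisVector 0) 0 :=
          mul_nonneg hσ0 (horth j).le
        linarith
    · show R₀ ≤ (d.background j).radius (x.1 + σ • ((d.motion j).1 : E4 ≃L[ℝ] E4) (E4.basisVector 0))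
      rw [radius_ride]
      exact hr₀
    · show (d.background j).radius (x.1 + σ • ((d.motion j).1 : E4 ≃L[ℝ] E4) (E4.basisVector 0)) ≤
        R j ((d.background j).time (x.1 + σ • ((d.motion j).1 : E4 ≃L[ℝ] E4) (E4.basisVector 0)))
      rw [radius_ride, time_ride]
      exact hrR.trans (hmono j (by linarith))

/-- **A contact point is a ride-able certified tube point** (chart bookkeeping only): a
flat-late `c ∈ U`, `τ₀ < c⁰ ≤ τ₁`, inside a closed certified tube `rₖ(c) ≤ Rₖ(tₖ c)` satisfies:
SEAMED (7) puts `c` outside every flat tube, so `rₖ(c) > ρₖ(c⁰) ≥ R₀ ≥ 100 Mₖ > r₊` (SEAMED (1),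
HonestCore (a)) and `c ∈ domₖ`; ONE ATLAS (6) gives `Φ c = Ψₖ c`; clock lag (9) (or hole-earliness)
gives `tₖ(c) ≤ τ₁`. Clauses: Hc (a) `100M ≤ R₀`, Sm (1) `R₀ ≤ ρ`, Sm (6), (7), (9).
DHRT arXiv:2104.08222, §1. [folklore] -/
theorem contact_mem_rideable {𝓢 : Spacetime.{0} 4} {O : Set 𝓢.carrier}
    (d : FinalStateDecomposition 𝓢 O 2) (R : Fin d.N → ℝ → ℝ) (R₀ : ℝ)
    (ha : ∀ i, 100 * d.mass i ≤ R₀)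
    (h1 : ∀ i s, R₀ ≤ d.excision i s)
    (h6 : ∀ i (y : E4) (hy : y ∈ (d.background i).domain), d.τ₀ ≤ y 0 →
      (∀ j, d.excision j (y 0) < (d.background j).radius y) →
      (d.background i).radius y ≤ R i ((d.background i).time y) + 1 →
      ∃ hy' : y ∈ d.flatDomain, d.chart i ⟨y, hy⟩ = d.flatChart ⟨y, hy'⟩)
    (h7 : ∀ y : d.flatDomain, d.τ₀ ≤ y.1 0 → ∀ j, d.excision j (y.1 0) < (d.background j).radius y.1)
    (h9 : ∀ j (y : E4), d.τ₀ ≤ (d.background j).time y →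
      (d.background j).radius y ≤ R j ((d.background j).time y) + 2 → (d.background j).time y ≤ y 0)
    (τ₁ : ℝ) (c : d.flatDomain) (k : Fin d.N) (hc₀ : d.τ₀ < c.1 0) (hc₁ : c.1 0 ≤ τ₁)
    (hrR : (d.background k).radius c.1 ≤ R k ((d.background k).time c.1)) :
    d.flatChart c ∈ ⋃ j, d.chart j '' {x | (d.τ₀ ≤ (d.background j).time x.1 ∨ d.τ₀ ≤ x.1 0) ∧
        R₀ ≤ (d.background j).radius x.1 ∧
        (d.background j).radius x.1 ≤ R j ((d.background j).time x.1) ∧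
        (d.background j).time x.1 ≤ τ₁} := by
  have hout : ∀ j, d.excision j (c.1 0) < (d.background j).radius c.1 := h7 c hc₀.le
  have hR₀r : R₀ < (d.background k).radius c.1 := lt_of_le_of_lt (h1 k (c.1 0)) (hout k)
  -- `c` lies in the chart domain of hole `k`
  have hM := d.mass_pos k
  have hdom : c.1 ∈ (d.background k).domain := by
    show poincareInv (d.motion k).1 (d.motion k).2 c.1 ∈ Kerr.exterior (d.mass k) (d.spin k)
    rw [Kerr.mem_exterior]
    have h2M := Kerr.rPlus_le_two_mul (a := d.spin k) hM.le
    have h100 := ha k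
    refine max_lt ?_ ?_
    · show Kerr.rPlus (d.mass k) (d.spin k) < (d.background k).radius c.1
      linarith
    · show (0 : ℝ) < (d.background k).radius c.1
      linarith
  -- one atlas
  obtain ⟨hc', hEq⟩ := h6 k c.1 hdom hc₀.le hout (by linarith)
  -- hole clock at most `τ₁`
  have htk : (d.background k).time c.1 ≤ τ₁ := by
    by_cases h : d.τ₀ ≤ (d.background k).time c.1
    · exact (h9 k c.1 h (by linarith)).trans hc₁
    · push Not at h
      linarith
  refine mem_iUnion.mpr ⟨k, ⟨c.1, hdom⟩, ⟨Or.inr hc₀.le, hR₀r.le, hrR, htk⟩, ?_⟩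
  -- `⟨c.1, hc'⟩ = c` by structure eta
  rw [hEq]

/-- **BOARD** (flat-late points drain to the certified slab): a flat-late point `Φ y` with
`τ₀ < y⁰ ≤ τ₁` lies in `J⁻(certifiedSlab d R τ₁)`. FIRST CONTACT (`stub_firstContact`): either the lab
ray reaches the flat slab (part of the certified slab), or it makes first contact at a flat-late point
`c` of a closed certified tube, which is ride-able (`contact_mem_rideable`) and rides to the hole disc
(`tubeRide`); `J⁻ ∘ J⁻ = J⁻`. Clauses: Hc (a) `100M ≤ R₀` + orthochronous, Hc (d), Sm (1), (5), (6),
(7), (8), (9). O'Neill 1983, Ch. 14, pp. 402–403. [folklore] -/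
theorem flatBoarding (𝓢 : Spacetime.{0} 4) (O : Set 𝓢.carrier) (d : FinalStateDecomposition 𝓢 O 2)
    (R : Fin d.N → ℝ → ℝ) (R₀ : ℝ)
    (ha : ∀ i, 100 * d.mass i ≤ R₀)
    (horth : ∀ i, 0 < ((d.motion i).1 : E4 ≃L[ℝ] E4) (E4.basisVector 0) 0)
    (hd : ∀ y : d.flatDomain, d.τ₀ < y.1 0 →
      𝓢.timeOrientation.IsFutureDirected (mfderiv 𝓘(ℝ, E4) (𝓡 4) d.flatChart y (E4.basisVector 0)))
    (h1 : ∀ i, Monotone (R i) ∧ Continuous (R i) ∧ ∀ s, R₀ + 4 ≤ R i s ∧ R₀ ≤ d.excision i s)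
    (h5 : ∀ i (x : (d.background i).domain),
      (d.τ₀ ≤ (d.background i).time x.1 ∨ d.τ₀ ≤ x.1 0) → R₀ ≤ (d.background i).radius x.1 →
      (d.background i).radius x.1 ≤ R i ((d.background i).time x.1) →
      𝓢.timeOrientation.IsFutureDirected
        (mfderiv 𝓘(ℝ, E4) (𝓡 4) (d.chart i) x (((d.motion i).1 : E4 ≃L[ℝ] E4) (E4.basisVector 0))))
    (h6 : ∀ i (y : E4) (hy : y ∈ (d.background i).domain), d.τ₀ ≤ y 0 →
      (∀ j, d.excision j (y 0) < (d.background j).radius y) →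
      (d.background i).radius y ≤ R i ((d.background i).time y) + 1 →
      ∃ hy' : y ∈ d.flatDomain, d.chart i ⟨y, hy⟩ = d.flatChart ⟨y, hy'⟩)
    (h7 : ∀ y : d.flatDomain, d.τ₀ ≤ y.1 0 → ∀ j, d.excision j (y.1 0) < (d.background j).radius y.1)
    (h8 : ∀ j (y : E4), d.τ₀ ≤ y 0 → (d.background j).radius y ≤ d.excision j (y 0) →
      (d.background j).radius y + 2 ≤ R j ((d.background j).time y))
    (h9 : ∀ j (y : E4), d.τ₀ ≤ (d.background j).time y →
      (d.background j).radius y ≤ R j ((d.background j).time y) + 2 → (d.background j).time y ≤ y 0)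
    (τ₁ : ℝ) (y : d.flatDomain) (hy₀ : d.τ₀ < y.1 0) (hy₁ : y.1 0 ≤ τ₁) :
    d.flatChart y ∈ 𝓢.metric.causalPast 𝓢.timeOrientation (certifiedSlab d R τ₁) := by
  have hride := tubeRide 𝓢 O d R R₀ horth (fun i ↦ (h1 i).1) h5 τ₁
  rcases stub_firstContact 𝓢 O d R hd (fun i ↦ (h1 i).2.1) h8 τ₁ y hy₀ hy₁ with
    hslab | ⟨c, k, hc₀, hc₁, hrR, hyc⟩
  · exact LorentzianMetric.causalFuture_mono (fun z hz ↦ Or.inl hz) hslab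
  · exact causalPast_trans hyc
      (hride (contact_mem_rideable d R R₀ ha (fun i s ↦ ((h1 i).2.2 s).2) h6 h7 h9 τ₁ c k hc₀ hc₁ hrR))

/-! ## Collars; the certified late region is open (lateral walls are flat-late) -/

/-- **Collar points are flat-late points in the same coordinates.** A hole-`i` coordinate point with
hole time `> τ₀` on the collar `Rᵢ(t) ≤ r ≤ Rᵢ(t) + 1` is flat-charted with the same coordinates and
lab time `≥ t`: clock lag (9) gives `t ≤ x⁰`, margin (8) read contrapositively puts it outside its own
flat tube and (12)+(8) outside the others, so one atlas (6) applies. DHRT arXiv:2104.08222, §1. [folklore] -/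
theorem collar_flat {𝓢 : Spacetime.{0} 4} {O : Set 𝓢.carrier} (d : FinalStateDecomposition 𝓢 O 2)
    (R : Fin d.N → ℝ → ℝ)
    (h6 : ∀ i (y : E4) (hy : y ∈ (d.background i).domain), d.τ₀ ≤ y 0 →
      (∀ j, d.excision j (y 0) < (d.background j).radius y) →
      (d.background i).radius y ≤ R i ((d.background i).time y) + 1 →
      ∃ hy' : y ∈ d.flatDomain, d.chart i ⟨y, hy⟩ = d.flatChart ⟨y, hy'⟩)
    (h8 : ∀ j (y : E4), d.τ₀ ≤ y 0 → (d.background j).radius y ≤ d.excision j (y 0) →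
      (d.background j).radius y + 2 ≤ R j ((d.background j).time y))
    (h9 : ∀ j (y : E4), d.τ₀ ≤ (d.background j).time y →
      (d.background j).radius y ≤ R j ((d.background j).time y) + 2 → (d.background j).time y ≤ y 0)
    (h12 : ∀ j j' (y : E4), j ≠ j' → (d.τ₀ ≤ y 0 ∨ d.τ₀ ≤ (d.background j).time y) →
      (d.background j).radius y ≤ R j ((d.background j).time y) + 1 →
      R j' ((d.background j').time y) + 1 < (d.background j').radius y)
    (i : Fin d.N) (x : (d.background i).domain) (ht : d.τ₀ < (d.background i).time x.1)
    (hlo : R i ((d.background i).time x.1) ≤ (d.background i).radius x.1)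
    (hhi : (d.background i).radius x.1 ≤ R i ((d.background i).time x.1) + 1) :
    ∃ hy' : x.1 ∈ d.flatDomain, d.chart i x = d.flatChart ⟨x.1, hy'⟩ ∧
      (d.background i).time x.1 ≤ x.1 0 := by
  have hlag : (d.background i).time x.1 ≤ x.1 0 := h9 i x.1 ht.le (by linarith)
  have hτ₀y : d.τ₀ ≤ x.1 0 := by linarith
  have hout : ∀ j, d.excision j (x.1 0) < (d.background j).radius x.1 := by
    intro j
    by_contra hj
    push Not at hj
    have h8' : (d.background j).radius x.1 + 2 ≤ R j ((d.background j).time x.1) := h8 j x.1 hτ₀y hj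
    rcases eq_or_ne j i with rfl | hji
    · linarith
    · have h12' : R j ((d.background j).time x.1) + 1 < (d.background j).radius x.1 :=
        h12 i j x.1 (Ne.symm hji) (Or.inl hτ₀y) hhi
      linarith
  obtain ⟨hy', hEq⟩ := h6 i x.1 x.2 hτ₀y hout hhi
  exact ⟨hy', hEq, hlag⟩

/-- Images of open subsets of the late region under a late chart are open (the chart restricted to
the late region is an open embedding). [folklore] -/
theorem isOpen_image_of_isLateChart {𝓢 : Spacetime.{0} 4} {B : ModelBackground}
    {𝒟 : Set 𝓢.carrier} {τ₀ : ℝ} {Ψ : B.domain → 𝓢.carrier} (hΨ : 𝓢.IsLateChart B 𝒟 τ₀ Ψ)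
    {U : Set B.domain} (hU : IsOpen U) (hUl : U ⊆ B.lateRegion τ₀) : IsOpen (Ψ '' U) := by
  have h := hΨ.isOpenEmbedding.isOpenMap (Subtype.val ⁻¹' U) (hU.preimage continuous_subtype_val)
  have hEq : (B.lateRegion τ₀).restrict Ψ '' (Subtype.val ⁻¹' U) = Ψ '' U := by
    ext z
    constructor
    · rintro ⟨⟨x, hxl⟩, hxU, rfl⟩
      exact ⟨x, hxU, rfl⟩
    · rintro ⟨x, hxU, rfl⟩
      exact ⟨⟨x, hUl hxU⟩, hxU, rfl⟩
  rw [← hEq]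
  exact h

/-- **The certified late region is open** under SEAMED: lateral walls `r = Rⱼ(t)`, `t > τ₁` are
flat-late interior points by `collar_flat`; the rest is open embeddings of open coordinate sets.
Clauses: Sm (1)-continuity, (6), (8), (9), (12). DHRT arXiv:2104.08222, §1. [folklore] -/
theorem isOpen_certifiedLate {𝓢 : Spacetime.{0} 4} {O : Set 𝓢.carrier} (d : FinalStateDecomposition 𝓢 O 2)
    (R : Fin d.N → ℝ → ℝ) (hRc : ∀ i, Continuous (R i))
    (h6 : ∀ i (y : E4) (hy : y ∈ (d.background i).domain), d.τ₀ ≤ y 0 →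
      (∀ j, d.excision j (y 0) < (d.background j).radius y) →
      (d.background i).radius y ≤ R i ((d.background i).time y) + 1 →
      ∃ hy' : y ∈ d.flatDomain, d.chart i ⟨y, hy⟩ = d.flatChart ⟨y, hy'⟩)
    (h8 : ∀ j (y : E4), d.τ₀ ≤ y 0 → (d.background j).radius y ≤ d.excision j (y 0) →
      (d.background j).radius y + 2 ≤ R j ((d.background j).time y))
    (h9 : ∀ j (y : E4), d.τ₀ ≤ (d.background j).time y →
      (d.background j).radius y ≤ R j ((d.background j).time y) + 2 → (d.background j).time y ≤ y 0)
    (h12 : ∀ j j' (y : E4), j ≠ j' → (d.τ₀ ≤ y 0 ∨ d.τ₀ ≤ (d.background j).time y) →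
      (d.background j).radius y ≤ R j ((d.background j).time y) + 1 →
      R j' ((d.background j').time y) + 1 < (d.background j').radius y)
    (τ₁ : ℝ) (hτ₁ : d.τ₀ < τ₁) : IsOpen (certifiedLate d R τ₁) := by
  -- continuity of the clocks and radii
  have hc0 : Continuous fun y : E4 ↦ y 0 := PiLp.continuous_apply 2 _ 0
  have ht : ∀ i, Continuous fun x : E4 ↦ (d.background i).time x := fun i ↦
    hc0.comp (continuous_poincareInv _ _)
  have hr : ∀ i, Continuous fun x : E4 ↦ (d.background i).radius x := fun i ↦
    (Kerr.continuous_radius _).comp (continuous_poincareInv _ _)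
  -- the open pieces
  have hF₀ : IsOpen (d.flatChart '' (Minkowski.backgroundOn d.flatDomain).lateRegion τ₁) := by
    refine isOpen_image_of_isLateChart d.isLateChart_flat ?_ fun y hy ↦ lt_trans hτ₁ hy
    exact isOpen_lt continuous_const (hc0.comp continuous_subtype_val)
  have hFi : ∀ i, IsOpen (d.chart i '' {x | τ₁ < (d.background i).time x.1 ∧
      (d.background i).radius x.1 < R i ((d.background i).time x.1)}) := by
    intro i
    refine isOpen_image_of_isLateChart (d.isLateChart i) ?_ fun x hx ↦ lt_trans hτ₁ hx.1
    exact (isOpen_lt continuous_const ((ht i).comp continuous_subtype_val)).and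
      (isOpen_lt ((hr i).comp continuous_subtype_val)
        ((hRc i).comp ((ht i).comp continuous_subtype_val)))
  -- `certifiedLate` is the union of the open pieces: lateral walls are flat-late
  have hEq : certifiedLate d R τ₁ =
      d.flatChart '' (Minkowski.backgroundOn d.flatDomain).lateRegion τ₁ ∪
        ⋃ i, d.chart i '' {x | τ₁ < (d.background i).time x.1 ∧
          (d.background i).radius x.1 < R i ((d.background i).time x.1)} := by
    refine Set.Subset.antisymm ?_ ?_
    · rintro z (hz | hz)
      · exact Or.inl hz
      · obtain ⟨j, x, ⟨hxt, hxr⟩, rfl⟩ := Set.mem_iUnion.mp hz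
        rcases lt_or_eq_of_le hxr with hlt | heq
        · exact Or.inr (Set.mem_iUnion.mpr ⟨j, x, ⟨hxt, hlt⟩, rfl⟩)
        · -- lateral wall point
          left
          obtain ⟨hy', hEqΦ, hlag⟩ := collar_flat d R h6 h8 h9 h12 j x (lt_trans hτ₁ hxt) heq.ge (by linarith)
          refine ⟨⟨x.1, hy'⟩, ?_, hEqΦ.symm⟩
          show τ₁ < x.1 0
          linarith
    · rintro z (hz | hz)
      · exact Or.inl hz
      · obtain ⟨j, x, ⟨hxt, hxr⟩, rfl⟩ := Set.mem_iUnion.mp hz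
        exact Or.inr (Set.mem_iUnion.mpr ⟨j, x, ⟨hxt, hxr.le⟩, rfl⟩)
  rw [hEq]
  exact hF₀.union (isOpen_iUnion hFi)

end Summit.FinalStateConjecture.FinalStateConjecture.Theorems.SeamedChartsExhaust.WideAnchoring

end
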